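import Literature.Analysis.FluidPDE.RusinSverakLerayWeakStrong
import Literature.Analysis.FluidPDE.RusinSverakKatoBoundHolds
import Literature.Analysis.FluidPDE.LocalEnergyExtension
import Literature.Analysis.FluidPDE.LocalLerayWeakStrongProofs
import Literature.Analysis.FluidPDE.KatoLocalLerayPressureProofs
import Literature.Analysis.FluidPDE.RusinSverakSingularPointsStableLeaves
import Literature.Analysis.FluidPDE.JiaSverak2013AprioriEstimate
import Literature.Analysis.FluidPDE.LocalLerayLimitingProcedureProofs
import Literature.Analysis.FluidPDE.CKNLocalRegularityRRSPressure
import HarnessLib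

/-!
# Rusin–Šverák, Cor. 4.2, over the six remaining leaves of its cone

Analysis/FluidPDE proof file (no definitions, no named facts) for the named fact
`Literature.Analysis.FluidPDE.rusin_sverak_weak_limit_of_singular_points`
(`RusinSverakWeakStability.lean`; W. Rusin, V. Šverák, *Minimal initial data for potential
Navier–Stokes singularities*, J. Funct. Anal. 260 (2011) 879–891 = arXiv:0911.0500, **Cor. 4.2**
p. 8: for data `u₀^k` bounded in `Ḣ^{1/2}` converging weakly to `u₀`, whose solutions have the
common maximal time `T` with singular points `(x_k, T)`, `x_k` bounded, the weak limit `u₀`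
blows up by time `T`; printed proof: "Apply the theorem [Thm. 4.2], together with Lemma 4.1,
Proposition 2.2 and Lemma 2.1", after the passage from mild to Leray solutions of §4 p. 6
(existence of Leray solutions, Thm. 4.1 = weak–strong uniqueness, "the only reason for
`T_max(u₀) < ∞` is a singularity")).

The accepted glue `rusin_sverak_weak_limit_of_singular_points_of_leray_theory`
(`RusinSverakLeraySolutions.lean`) derives Cor. 4.2 from four named facts of the Leray-solution
theory — **E** `leray_solution_exists_of_memLp_three`, **W** `leray_solution_ae_eq_kato`,
**R** `kato_solution_le_div_sqrt`, **S** `rusin_sverak_leray_singular_points_stable` — and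
`rusin_sverak_weak_limit_of_singular_points_of_local_leray_theory`
(`RusinSverakLerayWeakStrong.lean`) replaces **W** by **U** `local_leray_weak_strong_uniqueness`
and **A** `kato_isLocalLeraySolutionOn`. Since then the tree has discharged **R**
(`kato_solution_le_div_sqrt_holds`, `RusinSverakKatoBoundHolds.lean`), **A**
(`kato_isLocalLeraySolutionOn_holds`, `KatoLocalLerayPressureProofs.lean`), Rusin–Šverák's
Prop. 2.2 (`rusin_sverak_2011_proposition_2_2_holds`, `LocalLerayLimitingProcedureProofs.lean`)
and the two CKN inputs of **S** (`RRS2016.step2_force_holds`, `CKNLocalRegularityRRSStep2.lean`;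
`RRS2016.lemma15_12_holds`, `CKNLocalRegularityRRSPressure.lean`), and has reduced the other
three inputs:

* **E** `⇐ localLeraySolution_exists_of_memE2` (`leray_solution_exists_of_memLp_three_of_memE2`,
  `LocalLerayExistence.lean`) `⇐` local existence + extension for `E²` data
  (`localLeraySolution_exists_of_memE2_of_extension`, `LocalEnergyExtension.lean`);
* **U** `⇐ local_leray_difference_energy_estimate` (`local_leray_weak_strong_uniqueness_of`,
  `LocalLerayWeakStrongProofs.lean`);
* **S** `⇐` Jia–Šverák's Cor. 1 (`⇐` Lemma 2, `jia_sverak_2013_corollary_1_of_lemma_2`,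
  `JiaSverak2013AprioriEstimate.lean`), Lemma 8, the limiting procedure (`⇐` Cor. 1, Prop. 2.2 and
  the limit step, `localLeray_limiting_procedure_of_facts`, `LocalLerayLimitingProcedure.lean`)
  and the two CKN inputs (`rusin_sverak_leray_singular_points_stable_of_leaves`,
  `RusinSverakSingularPointsStableLeaves.lean`).

This file composes these reductions with the discharged theorems and records Cor. 4.2 as a
consequence of exactly the six named facts of its cone that are still undischarged (each a
published theorem with its own locator, quoted in its file) — the seven leaves recorded for
Cor. 4.3 in `rusin_sverak_minimal_data_compact_of_seven_leaves`
(`RusinSverakCompactnessSevenLeaves.lean`) minus the pressure decomposition, which Cor. 4.2 does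
not use:

1. `localEnergySolution_exists_local_of_memE2` — local-in-time local energy solutions for `E²`
   data (Lemarié-Rieusset 2016 Thm. 14.1; Seregin 2014 Prop. 1.8), `LocalEnergyExtension.lean`;
2. `localEnergySolution_extension_of_memE2` — the extension step (Seregin 2014 App. B §B.5;
   Lemarié-Rieusset 2016 Thm. 14.8, proof, Steps 1–3), `LocalEnergyExtension.lean`;
3. `local_leray_difference_energy_estimate` — the local energy estimate for the difference of
   two local Leray solutions (Lemarié-Rieusset 2016 Thm. 14.7, proof, pp. 515–518),
   `LocalLerayWeakStrongProofs.lean`;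
4. `jia_sverak_2013_lemma_2` — the a-priori local energy estimate for local Leray solutions
   (Jia–Šverák 2013 Lemma 2 with (2.9)), `JiaSverak2013AprioriEstimate.lean`;
5. `jia_sverak_2013_lemma_8` — the uniform initial layer (Jia–Šverák 2013 Lemma 8;
   Lemarié-Rieusset 2016 Prop. 15.1), `JiaSverak2013Compactness.lean`;
6. `localLeray_limit_isLocalLeraySolution` — the limit of local Leray solutions is a local Leray
   solution with the weak-limit datum (Jia–Šverák 2013, proof of Thm. 1, p. 8; Lemarié-Rieusset
   2016, proof of Thm. 15.5), `LocalLerayLimitingProcedure.lean`.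

So `rusin_sverak_weak_limit_of_singular_points_holds` is
`rusin_sverak_weak_limit_of_singular_points_of_six_leaves` applied to the six `_holds` theorems
once they exist; the file merges, already now, the import closures of the three sub-cones (local
energy existence, weak–strong uniqueness, Jia–Šverák compactness) with the Kato-side discharges,
so that the final discharge is a one-line file over this one.

## References

* W. Rusin, V. Šverák, J. Funct. Anal. 260 (2011) 879–891 = arXiv:0911.0500, Cor. 4.2 and its
  proof (p. 8), §4 p. 6, Thm. 4.1, Lemma 4.1, Thm. 4.2, Prop. 2.2, Lemma 2.1. [RusinSverak2011]
* P. G. Lemarié-Rieusset, *The Navier–Stokes Problem in the 21st Century*, CRC Press 2016,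
  doi:10.1201/b19556, Thms. 14.1, 14.7, 14.8, 15.1, Prop. 15.1, proof of Thm. 15.5.
  [LemarieRieusset2016]
* H. Jia, V. Šverák, *Minimal L³-initial data for potential Navier–Stokes singularities*,
  SIAM J. Math. Anal. 45 (2013) 1448–1459 = arXiv:1201.1592, Lemma 2, Cor. 1, Lemma 8, proof of
  Thm. 1. [JiaSverak2013]
* G. Seregin, *Lecture Notes on Regularity Theory for the Navier–Stokes Equations*, World
  Scientific 2014, App. B, Prop. 1.8 and §B.5. [Seregin2014Notes]
-/

noncomputable section

namespace Literature.Analysis.FluidPDE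

/-- **Rusin–Šverák, Cor. 4.2, over the six undischarged leaves of its cone.** The weak-limit
statement `rusin_sverak_weak_limit_of_singular_points` (weak `Ḣ^{1/2}`-limits of bounded data
whose Kato solutions are singular at `(T, x_k)`, `x_k → x_∞`, have no global Kato solution)
follows from local existence (1) and extension (2) of local energy solutions with `E²` data, the
difference energy estimate behind weak–strong uniqueness (3), Jia–Šverák's Lemma 2 (4) and
Lemma 8 (5), and the limit step of the local Leray limiting procedure (6); every other input of
the printed argument (Kato's `‖u(t)‖_∞ ≤ C/√t` bound **R**, the local Leray property of Kato
solutions **A**, Prop. 2.2, RRS Lemma 15.12 / Step 2 behind ε-regularity and the stability of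
singular points) is a theorem of the tree and is plugged in here.
[cite: RusinSverak2011, Cor. 4.2 and its proof (arXiv:0911.0500 p. 8), with §4 p. 6 and Thm. 4.1] -/
theorem rusin_sverak_weak_limit_of_singular_points_of_six_leaves
    (h₁ : localEnergySolution_exists_local_of_memE2)
    (h₂ : localEnergySolution_extension_of_memE2)
    (h₃ : local_leray_difference_energy_estimate)
    (h₄ : jia_sverak_2013_lemma_2) (h₅ : jia_sverak_2013_lemma_8)
    (h₆ : localLeray_limit_isLocalLeraySolution) :
    rusin_sverak_weak_limit_of_singular_points :=
  rusin_sverak_weak_limit_of_singular_points_of_local_leray_theory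
    (leray_solution_exists_of_memLp_three_of_memE2
      (localLeraySolution_exists_of_memE2_of_extension h₁ h₂))
    (local_leray_weak_strong_uniqueness_of h₃) kato_isLocalLeraySolutionOn_holds
    kato_solution_le_div_sqrt_holds
    (rusin_sverak_leray_singular_points_stable_of_leaves (jia_sverak_2013_corollary_1_of_lemma_2 h₄)
      h₅ (localLeray_limiting_procedure_of_facts (jia_sverak_2013_corollary_1_of_lemma_2 h₄)
        rusin_sverak_2011_proposition_2_2_holds h₆)
      RRS2016.step2_force_holds RRS2016.lemma15_12_holds)

/-- The four Leray-theory inputs **E**, **W**, **R**, **S** of the accepted glue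
`rusin_sverak_weak_limit_of_singular_points_of_leray_theory`, jointly, over the same six leaves
(so that every other consumer of E/W/S — Cor. 4.3, the weak-limit blow-up — can be fed from the
six `_holds` theorems through this file as well). [cite: RusinSverak2011, §4 p. 6, Thm. 4.1, Thm. 4.2 with Lemma 2.1 (arXiv:0911.0500 pp. 6–8)] -/
theorem leray_theory_inputs_of_six_leaves
    (h₁ : localEnergySolution_exists_local_of_memE2)
    (h₂ : localEnergySolution_extension_of_memE2)
    (h₃ : local_leray_difference_energy_estimate)
    (h₄ : jia_sverak_2013_lemma_2) (h₅ : jia_sverak_2013_lemma_8)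
    (h₆ : localLeray_limit_isLocalLeraySolution) :
    leray_solution_exists_of_memLp_three ∧ leray_solution_ae_eq_kato ∧
      kato_solution_le_div_sqrt ∧ rusin_sverak_leray_singular_points_stable :=
  ⟨leray_solution_exists_of_memLp_three_of_memE2
      (localLeraySolution_exists_of_memE2_of_extension h₁ h₂),
    leray_solution_ae_eq_kato_of_local_leray_theory (local_leray_weak_strong_uniqueness_of h₃)
      kato_isLocalLeraySolutionOn_holds,
    kato_solution_le_div_sqrt_holds,
    rusin_sverak_leray_singular_points_stable_of_leaves (jia_sverak_2013_corollary_1_of_lemma_2 h₄)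
      h₅ (localLeray_limiting_procedure_of_facts (jia_sverak_2013_corollary_1_of_lemma_2 h₄)
        rusin_sverak_2011_proposition_2_2_holds h₆)
      RRS2016.step2_force_holds RRS2016.lemma15_12_holds⟩

end Literature.Analysis.FluidPDE

end
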